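import Summits.HodgeConjecture.CorCM.Census.OcticWeilMultiParts
import Summits.HodgeConjecture.CorCM.DecicWeil23MultiFrameTransfer
import Summits.HodgeConjecture.CorCM.OcticWeilOrbitRealisers
import HarnessLib

/-!
# COR-CM — any number `r` of CM types over one OCTIC CM field `K ⊇ k`: `E × B₁ × ⋯ × B_r` (CM fourfolds of `k`-signature `(2,2)`
# or `(1,3)`) — the model map, the REALISED PERMUTATIONS of the four conjugate pairs, FRAME TRANSFER (no Galois hypothesis), and
# the divisor lines of conjugate pairs

Cell `pub-hodgecm2` (COR-CM), seat b30 gen 25 (2026-08-23); count-neutral own lane OCTIC-MULTI (geometry half), over the landed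
kernel census `Census/OcticWeilMulti{,Defect,Parts,Extraction}` (gen 24).  Theorems, plus TWO bookkeeping definitions (the model map
`toPtO` and the finset `realisedPermsO e` of permutations of the four conjugate pairs induced by automorphisms of `ℂ` — the four-pair
twins of gen 24's `DecicWeil23Multi.toPtM` and gen 23's `DecicWeil23Pair.realisedPerms`); the slots `DecicWeil23Multi.multiSlots r i₀ i₁`
(`(k, K, …, K)`, `Fin.cons`), `sigma_casesM`, `conj_smul_zeroM/succM` and gen 20's `OcticWeilOrbit.exists_perm_of_comp_tau_eq` are
reused BY NAME; no named fact, no `sorry`.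
SETTING: index type `I`, fields `Kf`, `r + 1` slots `multiSlots r i₀ i₁`; realisations `A j ⊨ (Kf (multiSlots r i₀ i₁ j); Φ j)`:
`E = A 0 ⊨ (k; {τ})` (`hΨ`), `B_m = A (m+1) ⊨ (K; Φ_(m+1))` with `s ∈ Φ_(m+1) ⟺ (e s).2 = P m (e s).1` (`hΦ`) for a frame
`e : Hom(K,ℂ) ≃ Fin 4 × Bool` (`(e s).2 = [s ∘ i = τ]`, `e s̄ = ((e s).1, ¬(e s).2)`).

* §0 `toPtO` (`(0, σ) ↦ inl [σ = τ]`, `(m+1, s) ↦ inr (m, e s)`), `toPtO_injective`, `toPtO_conj_smul`;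
* §1 `apply_comp_eq_of_realisesO` / `comp_eq_tau_iff_of_realisesO` (a realiser of `π` keeps signs, moves pair `a` to `π a`, fixes `τ`),
  `comp_mem_iff_toPtO_mem_phiO` — `ρ ∘ x ∈ Φ ⟺ toPtO x ∈ phiO P π`;
* §2 `realisedPermsO e` — closed under composition and inverse; **`twoTransitive_realisedPermsO`** from the frame `2`-transitivity
  `h2t` (every ordered pair of distinct conjugate pairs is moved to `(0, 1)` by `Aut(ℂ)`; Dodson: automatic when `K` carries a
  degenerate simple CM fourfold, gen 19's `OcticWeilFourfold.twoTransitive_of_isSimple`);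
* §3 **`modelBalancedO_of_isGaloisBalancedAlg`** — FRAME TRANSFER for every slot map `κ : Fin N → Fin (r+1)`: an `Aut(ℂ)`-balanced
  weight of `⨁_j A(κ j)` is a balanced configuration of the census model under `R = realisedPermsO e`, with NO Galois hypothesis;
* §4 `weightClassesAlg_le_algebraicClasses_of_isPairPartO` (pair parts have divisor lines).
HONEST FRAMING: nothing about the Hodge conjecture is concluded here; `HC_CM` is not asserted.
[cite: Pohlmann1968, Thm 1] [cite: GaoUllmo2025, Thm 3.1 (3.2)] [cite: Shimura1998, §18.2 Lemma (i)] [cite: DixonMortimer1996, §2.1]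
[cite: Gordon1999HodgeAVSurvey, 9.2.2] [cite: Milne2020HodgeClassesAV, 1.2 (a) and Thm. 1]

## References
* [Pohlmann1968] H. Pohlmann, Ann. of Math. 88 (1968), Thm 1.  [GaoUllmo2025] Z. Gao, E. Ullmo, J. Inst. Math. Jussieu 25 (2025),
  Thm 3.1 (3.2).  [Shimura1998] G. Shimura, *Abelian varieties with CM and modular functions*, §18.2 Lemma (i).  [DixonMortimer1996]
  J. D. Dixon, B. Mortimer, *Permutation Groups*, GTM 163 (1996), §2.1.  [Gordon1999HodgeAVSurvey] B. B. Gordon, CRM Monogr. 10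
  (1999), 9.2.2.  [Milne2020HodgeClassesAV] J. S. Milne, arXiv:2010.08857, 1.2 (a), Thm. 1.
-/

noncomputable section

open CategoryTheory CategoryTheory.Limits NumberField

namespace Summit.HodgeConjecture.CorCM.OcticWeilMulti

open Literature.AlgebraicGeometry Literature.AlgebraicGeometry.Motives Literature.AlgebraicGeometry.HodgeTheory
open Literature.AlgebraicGeometry.ComplexMultiplication (IsCMTypeRealisation)
open Literature.AlgebraicGeometry.Pohlmann1968
open Literature.AlgebraicTopology.SingularHomology
open Literature.NumberTheory.ComplexMultiplication
open Summit.HodgeConjecture.CorCM.Census.OcticWeilMulti (PtO cjO cjO_inl cjO_inr cjO_cjO cjO_ne phiO inl_mem_phiO inr_mem_phiO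
  ModelBalancedO IsPairPartO)
open Summit.HodgeConjecture.CorCM.DecicWeil23Multi (multiSlots sigma_casesM conj_smul_zeroM conj_smul_succM)
open Summit.HodgeConjecture.CorCM.OcticCurveFourfold (comp_injective comp_conjugate)
open Summit.HodgeConjecture.CorCM.OcticWeilOrbit (exists_perm_of_comp_tau_eq)
open Summit.HodgeConjecture.CorCM.CMWeights (weightClassesAlg_comp_le_algebraicClasses_of_injOn)
open Summit.HodgeConjecture.CorCM.PairWeights
open Summit.HodgeConjecture.CorCM.DihedralSexticPairCurvePowers (ncard_sep_eq_card_filter)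

open scoped Classical Pointwise

/-! ## §0 The model map -/

section Defs

variable {I : Type} {r : ℕ} {Kf : I → Type} [∀ i, Field (Kf i)] {i₀ i₁ : I}

/-- **The model map** `Hom(k × K × ⋯ × K, ℂ) → PtO r`: `(0, σ) ↦ inl [σ = τ]`, `(m+1, s) ↦ inr (m, e s)` (four conjugate pairs).
[folklore] -/
def toPtO (e : (Kf i₁ →+* ℂ) ≃ Fin 4 × Bool) (τ : Kf i₀ →+* ℂ) :
    ((j : Fin (r + 1)) × (Kf (multiSlots r i₀ i₁ j) →+* ℂ)) → PtO r := fun x =>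
  Fin.cases (motive := fun j => (Kf (multiSlots r i₀ i₁ j) →+* ℂ) → PtO r)
    (fun σ => Sum.inl (decide (σ = τ))) (fun m s => Sum.inr (m, e s)) x.1 x.2

/-- `toPtO` on the curve slot. [folklore] -/
@[simp] theorem toPtO_zero (e : (Kf i₁ →+* ℂ) ≃ Fin 4 × Bool) (τ : Kf i₀ →+* ℂ) (σ : Kf i₀ →+* ℂ) :
    toPtO (r := r) e τ ⟨0, σ⟩ = Sum.inl (decide (σ = τ)) := rfl

/-- `toPtO` on the fourfold slots. [folklore] -/
@[simp] theorem toPtO_succ (e : (Kf i₁ →+* ℂ) ≃ Fin 4 × Bool) (τ : Kf i₀ →+* ℂ) (m : Fin r) (s : Kf i₁ →+* ℂ) :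
    toPtO e τ ⟨m.succ, s⟩ = Sum.inr (m, e s) := rfl

end Defs

/-! ## §1 The model map: injectivity, conjugation; how a realiser of `π` acts -/

section Transfer

variable {I : Type} {r : ℕ} {Kf : I → Type} [∀ i, Field (Kf i)]
  {i₀ i₁ : I} {e : (Kf i₁ →+* ℂ) ≃ Fin 4 × Bool} {τ : Kf i₀ →+* ℂ}
  (hττ : ComplexEmbedding.conjugate τ ≠ τ) (hk : ∀ σ : Kf i₀ →+* ℂ, σ = τ ∨ σ = ComplexEmbedding.conjugate τ)

include hττ hk in
/-- The model map is injective (`Hom(k, ℂ) = {τ, τ̄}`, `e` a bijection, the slot is recorded). [folklore] -/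
theorem toPtO_injective : Function.Injective (toPtO (r := r) (i₀ := i₀) (i₁ := i₁) e τ) := by
  intro x y hxy
  rcases sigma_casesM x with ⟨σ, rfl⟩ | ⟨m, s, rfl⟩ <;> rcases sigma_casesM y with ⟨σ', rfl⟩ | ⟨m', s', rfl⟩
  · rw [toPtO_zero, toPtO_zero, Sum.inl.injEq] at hxy
    rcases hk σ with rfl | rfl <;> rcases hk σ' with rfl | rfl
    · rfl
    · simp only [decide_true] at hxy; exact absurd (of_decide_eq_true hxy.symm) hττ
    · simp only [decide_true] at hxy; exact absurd (of_decide_eq_true hxy) hττ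
    · rfl
  · exact absurd hxy (by rw [toPtO_zero, toPtO_succ]; exact Sum.inl_ne_inr)
  · exact absurd hxy (by rw [toPtO_zero, toPtO_succ]; exact Sum.inr_ne_inl)
  · rw [toPtO_succ, toPtO_succ, Sum.inr.injEq, Prod.mk.injEq] at hxy
    obtain ⟨rfl, h2⟩ := hxy
    rw [e.injective h2]

variable {i : Kf i₀ →+* Kf i₁}
  (he_sign : ∀ s : Kf i₁ →+* ℂ, (e s).2 = true ↔ s.comp i = τ)
  (he_conj : ∀ s : Kf i₁ →+* ℂ, e (ComplexEmbedding.conjugate s) = ((e s).1, !(e s).2))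

include he_conj hττ hk in
/-- Conjugation is read in the model: `toPtO x̄ = cjO (toPtO x)`. [folklore] -/
theorem toPtO_conj_smul (x : (j : Fin (r + 1)) × (Kf (multiSlots r i₀ i₁ j) →+* ℂ)) :
    toPtO e τ ((starRingAut : ℂ ≃+* ℂ) • x) = cjO (toPtO e τ x) := by
  rcases sigma_casesM x with ⟨σ, rfl⟩ | ⟨m, s, rfl⟩
  · have key : decide (ComplexEmbedding.conjugate σ = τ) = !decide (σ = τ) := by
      rcases hk σ with rfl | rfl
      · rw [decide_eq_false hττ]; simp
      · rw [ComplexEmbedding.involutive_conjugate, decide_eq_false hττ]; simp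
    rw [conj_smul_zeroM, toPtO_zero, toPtO_zero, key, cjO_inl]
  · rw [conj_smul_succM, toPtO_succ, toPtO_succ, he_conj, cjO_inr]

include he_conj in
/-- **A realiser of the permutation `π` of the four pairs acts on the frame by `e (ρ ∘ s) = (π (e s).1, (e s).2)`** (it keeps
the member over `τ` and commutes with complex conjugation). [cite: Shimura1998, §18.2 Lemma (i)] -/
theorem apply_comp_eq_of_realisesO [NumberField (Kf i₁)] [IsCMField (Kf i₁)] (ρ : ℂ ≃+* ℂ) {π : Equiv.Perm (Fin 4)}
    (hρ : ∀ a : Fin 4, (ρ : ℂ →+* ℂ).comp (e.symm (a, true)) = e.symm (π a, true)) (s : Kf i₁ →+* ℂ) :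
    e ((ρ : ℂ →+* ℂ).comp s) = (π (e s).1, (e s).2) := by
  cases h2 : (e s).2
  · have hs : s = ComplexEmbedding.conjugate (e.symm ((e s).1, true)) := by
      apply e.injective
      rw [he_conj, Equiv.apply_symm_apply]
      exact Prod.ext rfl (by rw [h2]; rfl)
    rw [hs, comp_conjugate ρ, he_conj, hρ, Equiv.apply_symm_apply, ← hs]
    rfl
  · have hs : s = e.symm ((e s).1, true) := by
      apply e.injective
      rw [Equiv.apply_symm_apply]
      exact Prod.ext rfl h2
    rw [hs, hρ, Equiv.apply_symm_apply, ← hs]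

include he_sign in
/-- **A realiser of `π` fixes `τ`.** [cite: Shimura1998, §18.2 Lemma (i)] -/
theorem comp_tau_eq_of_realisesO (ρ : ℂ ≃+* ℂ) {π : Equiv.Perm (Fin 4)}
    (hρ : ∀ a : Fin 4, (ρ : ℂ →+* ℂ).comp (e.symm (a, true)) = e.symm (π a, true)) : (ρ : ℂ →+* ℂ).comp τ = τ := by
  have h0 : (e.symm ((0 : Fin 4), true)).comp i = τ := (he_sign _).1 (by rw [Equiv.apply_symm_apply])
  have h1 : (e.symm (π 0, true)).comp i = τ := (he_sign _).1 (by rw [Equiv.apply_symm_apply])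
  calc (ρ : ℂ →+* ℂ).comp τ = ((ρ : ℂ →+* ℂ).comp (e.symm (0, true))).comp i := by rw [RingHom.comp_assoc, h0]
    _ = τ := by rw [hρ, h1]

include hττ hk he_sign in
/-- Hence on `Hom(k, ℂ) = {τ, τ̄}`: `ρ ∘ σ = τ ⟺ σ = τ`. [folklore] -/
theorem comp_eq_tau_iff_of_realisesO (ρ : ℂ ≃+* ℂ) {π : Equiv.Perm (Fin 4)}
    (hρ : ∀ a : Fin 4, (ρ : ℂ →+* ℂ).comp (e.symm (a, true)) = e.symm (π a, true)) (σ : Kf i₀ →+* ℂ) :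
    (ρ : ℂ →+* ℂ).comp σ = τ ↔ σ = τ := by
  have hρτ := comp_tau_eq_of_realisesO he_sign ρ hρ
  rcases hk σ with rfl | rfl
  · exact ⟨fun _ => rfl, fun _ => hρτ⟩
  · constructor
    · intro h
      exact absurd (comp_injective (K := Kf i₀) ρ (h.trans hρτ.symm)) hττ
    · intro h
      exact absurd h hττ

variable {P : Fin r → Fin 4 → Bool} {Φ : ∀ j : Fin (r + 1), CMType (Kf (multiSlots r i₀ i₁ j))}
  (hΦ : ∀ (m : Fin r) (s : Kf i₁ →+* ℂ), s ∈ (Φ m.succ).1 ↔ (e s).2 = P m (e s).1)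
  (hΨ : ∀ σ : Kf i₀ →+* ℂ, σ ∈ (Φ 0).1 ↔ σ = τ)

include hττ hk he_sign he_conj hΦ hΨ in
/-- **Membership read in the frame**: for a realiser `ρ` of the permutation `π` of the pairs, `ρ ∘ x ∈ Φ ⟺ toPtO x ∈ phiO P π`
(on the curve slot `ρ` fixes `τ`; on a fourfold slot `ρ` keeps signs and moves the pair `a` to `π a`).
[cite: GaoUllmo2025, Thm 3.1 (3.2)] [cite: Shimura1998, §18.2 Lemma (i)] -/
theorem comp_mem_iff_toPtO_mem_phiO [NumberField (Kf i₁)] [IsCMField (Kf i₁)] {ρ : ℂ ≃+* ℂ} {π : Equiv.Perm (Fin 4)}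
    (hρ : ∀ a : Fin 4, (ρ : ℂ →+* ℂ).comp (e.symm (a, true)) = e.symm (π a, true))
    (x : (j : Fin (r + 1)) × (Kf (multiSlots r i₀ i₁ j) →+* ℂ)) :
    (ρ : ℂ →+* ℂ).comp x.2 ∈ (Φ x.1).1 ↔ toPtO e τ x ∈ phiO P π := by
  rcases sigma_casesM x with ⟨σ, rfl⟩ | ⟨m, s, rfl⟩
  · change (ρ : ℂ →+* ℂ).comp σ ∈ (Φ 0).1 ↔ _
    rw [hΨ, toPtO_zero, inl_mem_phiO, comp_eq_tau_iff_of_realisesO hττ hk he_sign ρ hρ σ]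
    exact ⟨fun h => decide_eq_true h, fun h => of_decide_eq_true h⟩
  · change (ρ : ℂ →+* ℂ).comp s ∈ (Φ m.succ).1 ↔ _
    rw [hΦ, toPtO_succ, apply_comp_eq_of_realisesO he_conj ρ hρ s, inr_mem_phiO]

end Transfer

/-! ## §2 The realised permutations of the four conjugate pairs -/

section Realised

variable {F k : Type} [Field F] [Field k]

/-- **The realised permutations of the four conjugate pairs**: those `π` induced by some automorphism `ρ` of `ℂ`
(`ρ ∘ e⁻¹(a, true) = e⁻¹(π a, true)` for all `a`). [cite: Shimura1998, §18.2 Lemma (i)] -/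
def realisedPermsO (e : (F →+* ℂ) ≃ Fin 4 × Bool) : Finset (Equiv.Perm (Fin 4)) :=
  Finset.univ.filter fun π => ∃ ρ : ℂ ≃+* ℂ, ∀ a : Fin 4, (ρ : ℂ →+* ℂ).comp (e.symm (a, true)) = e.symm (π a, true)

variable (e : (F →+* ℂ) ≃ Fin 4 × Bool)

/-- Membership in `realisedPermsO e`. [folklore] -/
theorem mem_realisedPermsO (π : Equiv.Perm (Fin 4)) :
    π ∈ realisedPermsO e ↔ ∃ ρ : ℂ ≃+* ℂ, ∀ a : Fin 4, (ρ : ℂ →+* ℂ).comp (e.symm (a, true)) = e.symm (π a, true) := by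
  simp [realisedPermsO]

/-- **Closed under composition** (compose the automorphisms). [folklore] -/
theorem mul_mem_realisedPermsO : ∀ π₁ ∈ realisedPermsO e, ∀ π₂ ∈ realisedPermsO e, π₁ * π₂ ∈ realisedPermsO e := by
  intro π₁ h₁ π₂ h₂
  obtain ⟨ρ₁, h₁⟩ := (mem_realisedPermsO e π₁).1 h₁
  obtain ⟨ρ₂, h₂⟩ := (mem_realisedPermsO e π₂).1 h₂
  refine (mem_realisedPermsO e _).2 ⟨ρ₂.trans ρ₁, fun a => ?_⟩
  rw [RingEquiv.coe_ringHom_trans, RingHom.comp_assoc, h₂ a, h₁ (π₂ a), Equiv.Perm.mul_apply]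

/-- **Closed under inverse** (invert the automorphism). [folklore] -/
theorem inv_mem_realisedPermsO : ∀ π ∈ realisedPermsO e, π⁻¹ ∈ realisedPermsO e := by
  intro π h
  obtain ⟨ρ, h⟩ := (mem_realisedPermsO e π).1 h
  refine (mem_realisedPermsO e _).2 ⟨ρ.symm, fun a => ?_⟩
  have key := h (π⁻¹ a)
  rw [show π (π⁻¹ a) = a from (Equiv.apply_eq_iff_eq_symm_apply π).mpr rfl] at key
  rw [← key, ← RingHom.comp_assoc]
  have : ((ρ.symm : ℂ ≃+* ℂ) : ℂ →+* ℂ).comp (ρ : ℂ →+* ℂ) = RingHom.id ℂ := RingHom.ext fun z => ρ.symm_apply_apply z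
  rw [this, RingHom.id_comp]

variable {e} {τ : k →+* ℂ} {i : k →+* F} (he_sign : ∀ s : F →+* ℂ, (e s).2 = true ↔ s.comp i = τ)

include he_sign in
/-- **An automorphism moving `(a, b)` to `(0, 1)` yields a realised permutation with `π a = 0`, `π b = 1`** (it fixes `τ`, hence
permutes the pairs: gen 20's `OcticWeilOrbit.exists_perm_of_comp_tau_eq`). [cite: Shimura1998, §18.2 Lemma (i)] -/
theorem exists_mem_realisedPermsO_of_moves {a b : Fin 4} {ρ : ℂ ≃+* ℂ}
    (ha : (ρ : ℂ →+* ℂ).comp (e.symm (a, true)) = e.symm (0, true))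
    (hb : (ρ : ℂ →+* ℂ).comp (e.symm (b, true)) = e.symm (1, true)) :
    ∃ π ∈ realisedPermsO e, π a = 0 ∧ π b = 1 := by
  have hρτ : (ρ : ℂ →+* ℂ).comp τ = τ := by
    have ha' : (e.symm (a, true)).comp i = τ := (he_sign _).1 (by rw [Equiv.apply_symm_apply])
    have h0 : (e.symm ((0 : Fin 4), true)).comp i = τ := (he_sign _).1 (by rw [Equiv.apply_symm_apply])
    calc (ρ : ℂ →+* ℂ).comp τ = ((ρ : ℂ →+* ℂ).comp (e.symm (a, true))).comp i := by rw [RingHom.comp_assoc, ha']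
      _ = τ := by rw [ha, h0]
  obtain ⟨π, hπ⟩ := exists_perm_of_comp_tau_eq he_sign ρ hρτ
  refine ⟨π, (mem_realisedPermsO e π).2 ⟨ρ, hπ⟩, ?_, ?_⟩
  · exact (Prod.mk.inj (e.symm.injective ((hπ a).symm.trans ha))).1
  · exact (Prod.mk.inj (e.symm.injective ((hπ b).symm.trans hb))).1

include he_sign in
/-- **`2`-TRANSITIVITY of the realised permutations under `h2t`**: if every ordered pair of distinct conjugate pairs is moved to
`(0, 1)` by an automorphism of `ℂ`, then for `a ≠ b`, `x ≠ y` some realised `π` has `π a = x`, `π b = y`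
(`π = π_{xy}⁻¹ ∘ π_{ab}`). [cite: DixonMortimer1996, §2.1] -/
theorem twoTransitive_realisedPermsO
    (h2t : ∀ a b : Fin 4, a ≠ b → ∃ ρ : ℂ ≃+* ℂ,
      (ρ : ℂ →+* ℂ).comp (e.symm (a, true)) = e.symm (0, true) ∧ (ρ : ℂ →+* ℂ).comp (e.symm (b, true)) = e.symm (1, true)) :
    ∀ a b x y : Fin 4, a ≠ b → x ≠ y → ∃ π ∈ realisedPermsO e, π a = x ∧ π b = y := by
  intro a b x y hab hxy
  obtain ⟨ρ₁, h₁a, h₁b⟩ := h2t a b hab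
  obtain ⟨ρ₂, h₂x, h₂y⟩ := h2t x y hxy
  obtain ⟨π₁, hπ₁, hπ₁a, hπ₁b⟩ := exists_mem_realisedPermsO_of_moves he_sign h₁a h₁b
  obtain ⟨π₂, hπ₂, hπ₂x, hπ₂y⟩ := exists_mem_realisedPermsO_of_moves he_sign h₂x h₂y
  refine ⟨π₂⁻¹ * π₁, mul_mem_realisedPermsO e _ (inv_mem_realisedPermsO e _ hπ₂) _ hπ₁, ?_, ?_⟩
  · rw [Equiv.Perm.mul_apply, hπ₁a, ← hπ₂x]
    exact π₂.symm_apply_apply x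
  · rw [Equiv.Perm.mul_apply, hπ₁b, ← hπ₂y]
    exact π₂.symm_apply_apply y

end Realised

/-! ## §3 Frame transfer for the products of copies, no Galois hypothesis -/

section FrameTransfer

variable {I : Type} {r : ℕ} {Kf : I → Type} [∀ i, Field (Kf i)]
  {i₀ i₁ : I} {e : (Kf i₁ →+* ℂ) ≃ Fin 4 × Bool} {τ : Kf i₀ →+* ℂ}
  (hττ : ComplexEmbedding.conjugate τ ≠ τ) (hk : ∀ σ : Kf i₀ →+* ℂ, σ = τ ∨ σ = ComplexEmbedding.conjugate τ)
  {i : Kf i₀ →+* Kf i₁}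
  (he_sign : ∀ s : Kf i₁ →+* ℂ, (e s).2 = true ↔ s.comp i = τ)
  (he_conj : ∀ s : Kf i₁ →+* ℂ, e (ComplexEmbedding.conjugate s) = ((e s).1, !(e s).2))
  {P : Fin r → Fin 4 → Bool} {Φ : ∀ j : Fin (r + 1), CMType (Kf (multiSlots r i₀ i₁ j))}
  (hΦ : ∀ (m : Fin r) (s : Kf i₁ →+* ℂ), s ∈ (Φ m.succ).1 ↔ (e s).2 = P m (e s).1)
  (hΨ : ∀ σ : Kf i₀ →+* ℂ, σ ∈ (Φ 0).1 ↔ σ = τ)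
  {N : ℕ} (κ : Fin N → Fin (r + 1))

include hττ hk he_sign he_conj hΦ hΨ in
/-- **FRAME TRANSFER, no Galois hypothesis**: an `Aut(ℂ)`-balanced weight of `X = ⨁_j A(κ j)` (`IsGaloisBalancedAlg` for the CM
algebra `∏_j K_{κ j}`, types `Φ (κ j)`) is a balanced configuration of the census model under EVERY realised permutation of the
four pairs (`R = realisedPermsO e`), via `v = toPtO e τ ∘ P`, `P (j, s) = (κ j, s)`. [cite: GaoUllmo2025, Thm 3.1 (3.2)]
[cite: Pohlmann1968, Thm 1] -/
theorem modelBalancedO_of_isGaloisBalancedAlg [NumberField (Kf i₁)] [IsCMField (Kf i₁)]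
    {S : Finset ((j : Fin N) × (Kf (multiSlots r i₀ i₁ (κ j)) →+* ℂ))}
    (hS : IsGaloisBalancedAlg (K := fun j => Kf (multiSlots r i₀ i₁ (κ j))) (fun j => Φ (κ j)) S) :
    ModelBalancedO P (realisedPermsO e) (fun x => toPtO e τ ((Sigma.map κ (fun _ => id) :
      ((j : Fin N) × (Kf (multiSlots r i₀ i₁ (κ j)) →+* ℂ)) → ((m : Fin (r + 1)) × (Kf (multiSlots r i₀ i₁ m) →+* ℂ))) x)) S := by
  intro π hπ
  beta_reduce
  obtain ⟨ρ, hρ⟩ := (mem_realisedPermsO e π).1 hπ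
  have h := hS ρ
  rw [ncard_sep_eq_card_filter, ncard_sep_eq_card_filter] at h
  have key : ∀ x : (j : Fin N) × (Kf (multiSlots r i₀ i₁ (κ j)) →+* ℂ),
      (ρ : ℂ →+* ℂ).comp x.2 ∈ (Φ (κ x.1)).1 ↔ toPtO e τ ((Sigma.map κ (fun _ => id) :
        ((j : Fin N) × (Kf (multiSlots r i₀ i₁ (κ j)) →+* ℂ)) → ((m : Fin (r + 1)) × (Kf (multiSlots r i₀ i₁ m) →+* ℂ))) x)
          ∈ phiO P π :=
    fun x => comp_mem_iff_toPtO_mem_phiO hττ hk he_sign he_conj hΦ hΨ hρ ⟨κ x.1, x.2⟩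
  rw [Finset.filter_congr fun x _ => key x, Finset.filter_congr fun x _ => (key x).not] at h
  have htot := Finset.card_filter_add_card_filter_not
    (s := S) (fun x => toPtO e τ ((Sigma.map κ (fun _ => id) :
        ((j : Fin N) × (Kf (multiSlots r i₀ i₁ (κ j)) →+* ℂ)) → ((m : Fin (r + 1)) × (Kf (multiSlots r i₀ i₁ m) →+* ℂ))) x)
          ∈ phiO P π)
  omega

end FrameTransfer

/-! ## §4 Conjugate pairs have algebraic (divisor) lines -/

section Pairs

variable {I : Type} {r : ℕ} {Kf : I → Type} [∀ i, Field (Kf i)] [∀ i, NumberField (Kf i)] [∀ i, IsCMField (Kf i)]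
  {i₀ i₁ : I} {N : ℕ} (κ : Fin N → Fin (r + 1)) {e : (Kf i₁ →+* ℂ) ≃ Fin 4 × Bool} {τ : Kf i₀ →+* ℂ}
  (hττ : ComplexEmbedding.conjugate τ ≠ τ) (hk : ∀ σ : Kf i₀ →+* ℂ, σ = τ ∨ σ = ComplexEmbedding.conjugate τ)
  (he_conj : ∀ s : Kf i₁ →+* ℂ, e (ComplexEmbedding.conjugate s) = ((e s).1, !(e s).2))
  {A : Fin (r + 1) → AbelianVariety ℂ} {Φ : ∀ j : Fin (r + 1), CMType (Kf (multiSlots r i₀ i₁ j))}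
  {ι : ∀ j, 𝓞 (Kf (multiSlots r i₀ i₁ j)) →+* End (A j)}
  {θ : ∀ j, Kf (multiSlots r i₀ i₁ j) →+* Module.End ℂ (complexBetti (A j).X 1)}
  (hA : ∀ j, IsCMTypeRealisation (Φ j) (A j) (ι j) (θ j))

include hττ hk he_conj hA in
/-- **A weight of `Y = ⨁ A` whose model image is a conjugate pair `{y, cjO y}` is conjugation-stable, so its line is algebraic** (a
divisor line: Lefschetz `(1,1)` on the abelian variety `⨁ A`). [cite: Gordon1999HodgeAVSurvey, 9.2.2] -/
theorem weightClassesAlg_le_algebraicClasses_of_image_eq_pairO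
    {T : Finset ((j : Fin (r + 1)) × (Kf (multiSlots r i₀ i₁ j) →+* ℂ))} {y : PtO r} (hT : T.image (toPtO e τ) = {y, cjO y}) :
    T.card = 2 ∧ weightClassesAlg A ι (2 * 1) T ≤ algebraicClasses (⨁ A).X 1 := by
  have hinj := toPtO_injective (r := r) (e := e) hττ hk (i₁ := i₁)
  have hcard : T.card = 2 := by
    rw [← Finset.card_image_of_injective T hinj, hT]
    exact Finset.card_pair (cjO_ne y).symm
  refine ⟨hcard, weightClassesAlg_le_algebraicClasses_of_conj_smul_mem hA (m := 1) hcard fun x hx => ?_⟩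
  have hx' : toPtO e τ x ∈ ({y, cjO y} : Finset (PtO r)) := hT ▸ Finset.mem_image_of_mem _ hx
  have hcx : toPtO e τ ((starRingAut : ℂ ≃+* ℂ) • x) ∈ T.image (toPtO e τ) := by
    rw [toPtO_conj_smul hττ hk he_conj x, hT, Finset.mem_insert, Finset.mem_singleton] at *
    rcases hx' with h | h
    · exact Or.inr (by rw [h])
    · exact Or.inl (by rw [h, cjO_cjO])
  exact (hinj.mem_finset_image).1 hcx

include hττ hk he_conj hA in
/-- **A pair part of a weight of `X = ⨁_j A(κ j)` has an algebraic (divisor) line**: the model map is injective on it with image a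
conjugate pair, so its slot projection to `Y = ⨁ A` is a weight with the same image — a divisor line — lifted along `κ`
(distribution lemma). [cite: Gordon1999HodgeAVSurvey, 9.2.2] [cite: Milne2020HodgeClassesAV, 1.2 (a) and Thm. 1] -/
theorem weightClassesAlg_le_algebraicClasses_of_isPairPartO
    {G : Finset ((j : Fin N) × (Kf (multiSlots r i₀ i₁ (κ j)) →+* ℂ))}
    (hG : IsPairPartO (fun x => toPtO e τ ((Sigma.map κ (fun _ => id) :
      ((j : Fin N) × (Kf (multiSlots r i₀ i₁ (κ j)) →+* ℂ)) → ((m : Fin (r + 1)) × (Kf (multiSlots r i₀ i₁ m) →+* ℂ))) x)) G) :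
    G.card = 2 * 1 ∧ weightClassesAlg (fun j => A (κ j)) (fun j => ι (κ j)) (2 * 1) G ≤
      algebraicClasses (⨁ fun j => A (κ j)).X 1 := by
  obtain ⟨y, hcard, hinj, himg⟩ := hG
  set Pm : ((j : Fin N) × (Kf (multiSlots r i₀ i₁ (κ j)) →+* ℂ)) → ((m : Fin (r + 1)) × (Kf (multiSlots r i₀ i₁ m) →+* ℂ)) :=
    Sigma.map κ (fun _ => id) with hPm
  have hPinj : Set.InjOn Pm ↑G := fun x hx x' hx' h => hinj hx hx' (by change toPtO e τ (Pm x) = toPtO e τ (Pm x'); rw [h])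
  set TY : Finset ((m : Fin (r + 1)) × (Kf (multiSlots r i₀ i₁ m) →+* ℂ)) := G.image Pm with hTY
  have hTYimg : TY.image (toPtO e τ) = {y, cjO y} := by rw [hTY, Finset.image_image]; exact himg
  obtain ⟨-, hYalg⟩ := weightClassesAlg_le_algebraicClasses_of_image_eq_pairO hττ hk he_conj hA hTYimg
  have hq : G.card = 2 * 1 := by rw [hcard]
  exact ⟨hq, weightClassesAlg_comp_le_algebraicClasses_of_injOn (K := fun m => Kf (multiSlots r i₀ i₁ m)) hA κ hq hPinj hYalg⟩

end Pairs

end Summit.HodgeConjecture.CorCM.OcticWeilMulti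

end
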